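import Literature.Barriers.CriticalPhenomena.GridSAWCountingViaGridHamPath
import Literature.Combinatorics.SimpleGraph.HamiltonianPathCount
import HarnessLib

/-!
# `hamPathCount` of a drawn graph is a `hamCount`; relabelling invariance of the counts

Glue between the counting problem `GRIDHAMPATHCOUNT` of the barrier files (instances
`(P, D, s, t)`: vertices `0, …, N - 1`, edge list `D : List DrawnEdge`, count
`GridSAW.hamPathCount N D s t` of the vertex lists `IsHamPath N D s t l`,
`GridSAWCountingViaGridHamPath.lean`) and the combinatorial theory of Hamiltonian-path counts of
`Literature/Combinatorics/SimpleGraph/HamiltonianPathCount.lean` (`IsHamPathOn G V s t l`,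
`hamCount`, `hamCountRF` for a `SimpleGraph` on any vertex type), in which the gadget censuses
and the local-replacement theorem for the reduction of Liśkiewicz–Ogihara–Toda 2003, Lemma 4
(`LOT2003_lemma4_gadgets`) are proved. The gadget graph `G(ψ)` of that reduction is naturally a
graph on a structured vertex type; the instance handed to `GRIDHAMPATHCOUNT` numbers its vertices.
This file proves that nothing is lost in between:

* `drawnGraph D : SimpleGraph ℕ` — the abstract graph of an edge list (`DAdj` made irreflexive),
  `isHamPath_iff_isHamPathOn`, **`hamPathCount_eq_hamCount`**:
  `hamPathCount N D s t = hamCount (drawnGraph D) (Finset.range N) s t`;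
* **relabelling invariance**: along an injective map `f` of the vertices compatible with the two
  adjacencies on `V`, `hamCountRF` (hence `hamCount`) of `G` through `V` equals that of `G'`
  through `V.image f` with the constraints pushed forward (`hamCountRF_image`, `hamCount_image`);
* the combination **`hamPathCount_eq_hamCount_of_numbering`**: if `f` numbers the vertices of `V`
  by `0, …, N - 1` and `D` lists, between numbers of vertices of `V`, exactly the edges of `G`,
  then `hamPathCount N D (f s) (f t) = hamCount G V s t`.

## References

* M. Liśkiewicz, M. Ogihara, S. Toda, TCS 304 (2003) 129–156, §2.3 (#HamPath), §3–§4.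
* M. R. Garey, D. S. Johnson, *Computers and Intractability*, Freeman 1979, §3.2.2.
-/

namespace Literature.Barriers.CriticalPhenomena.GridSAW

open Literature.Combinatorics.SimpleGraph

/-! ### The abstract graph of an edge list -/

/-- **The simple graph of an edge list** `D` on the vertex type `ℕ`: `a ≠ b` adjacent iff some
drawn edge has ends `{a, b}` (`DAdj D a b`); loops, which no Hamiltonian path uses, are dropped.
[cite: LiskiewiczOgiharaToda2003, §2.3 (#HamPath)] -/
def drawnGraph (D : List DrawnEdge) : _root_.SimpleGraph ℕ :=
  _root_.SimpleGraph.fromRel fun a b => ∃ e ∈ D, e.1 = a ∧ e.2.1 = b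

/-- Adjacency in `drawnGraph D` is `DAdj D` between distinct vertices. [folklore] -/
theorem drawnGraph_adj (D : List DrawnEdge) (a b : ℕ) :
    (drawnGraph D).Adj a b ↔ a ≠ b ∧ DAdj D a b := by
  rw [drawnGraph, _root_.SimpleGraph.fromRel_adj]
  refine and_congr_right fun _ => ?_
  constructor
  · rintro (⟨e, he, h⟩ | ⟨e, he, h⟩)
    exacts [⟨e, he, Or.inl h⟩, ⟨e, he, Or.inr h⟩]
  · rintro ⟨e, he, h | h⟩
    exacts [Or.inl ⟨e, he, h⟩, Or.inr ⟨e, he, h⟩]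

/-- Decidability of adjacency in `drawnGraph D`. [folklore] -/
instance (D : List DrawnEdge) : DecidableRel (drawnGraph D).Adj := by
  unfold drawnGraph; infer_instance

/-- In a list without repeats, a chain for `R` is a chain for `R` restricted to distinct
entries. [folklore] -/
theorem isChain_ne_and_iff_of_nodup {α : Type*} {R : α → α → Prop} {l : List α} (hl : l.Nodup) :
    List.IsChain (fun a b => a ≠ b ∧ R a b) l ↔ List.IsChain R l := by
  constructor
  · exact fun h => h.imp fun _ _ hab => hab.2
  · intro h
    induction l with
    | nil => exact List.IsChain.nil
    | cons a l ih =>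
      cases l with
      | nil => exact List.IsChain.singleton a
      | cons b l =>
        have hab : a ≠ b := fun heq => (List.nodup_cons.1 hl).1 (heq ▸ List.mem_cons_self)
        exact List.IsChain.cons_cons ⟨hab, h.rel⟩ (ih hl.of_cons h.tail)

/-- **`IsHamPath` is `IsHamPathOn` of the drawn graph through `{0, …, N-1}`.**
[cite: LiskiewiczOgiharaToda2003, §2.3 (#HamPath)] -/
theorem isHamPath_iff_isHamPathOn (N : ℕ) (D : List DrawnEdge) (s t : ℕ) (l : List ℕ) :
    IsHamPath N D s t l ↔ IsHamPathOn (drawnGraph D) (Finset.range N) s t l := by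
  have hrange : (List.range N).toFinset = Finset.range N := by ext x; simp
  unfold IsHamPath IsHamPathOn
  constructor
  · rintro ⟨hperm, hh, ht, hch⟩
    have hnd : l.Nodup := hperm.nodup_iff.2 List.nodup_range
    refine ⟨hnd, by rw [List.toFinset_eq_of_perm _ _ hperm, hrange], hh, ht, ?_⟩
    refine (List.IsChain.iff fun a b => drawnGraph_adj D a b).2 ?_
    exact (isChain_ne_and_iff_of_nodup hnd).2 hch
  · rintro ⟨hnd, hV, hh, ht, hch⟩
    refine ⟨List.perm_of_nodup_nodup_toFinset_eq hnd List.nodup_range (by rw [hV, hrange]), hh,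
      ht, ?_⟩
    exact (isChain_ne_and_iff_of_nodup hnd).1
      ((List.IsChain.iff fun a b => drawnGraph_adj D a b).1 hch)

/-- **`hamPathCount` is a `hamCount`**: the number of Hamiltonian `s`–`t` paths of the instance
`(N, D)` is the Hamiltonian-path count of `drawnGraph D` through `{0, …, N - 1}`.
[cite: LiskiewiczOgiharaToda2003, §2.3 (#HamPath)] -/
theorem hamPathCount_eq_hamCount (N : ℕ) (D : List DrawnEdge) (s t : ℕ) :
    hamPathCount N D s t = hamCount (drawnGraph D) (Finset.range N) s t := by
  rw [hamPathCount, hamCount_eq, hamCountRF]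
  congr 1
  ext l
  rw [Set.mem_setOf_eq, mem_hamSetRF_empty, isHamPath_iff_isHamPathOn]

/-! ### Relabelling invariance -/

section relabel

variable {α β : Type*} [DecidableEq α] [DecidableEq β]

omit [DecidableEq α] in
/-- A list whose entries lie in the image of `V` under `f` is the image of a list. [folklore] -/
theorem exists_map_eq_of_forall_mem_image {f : α → β} {V : Finset α} {l' : List β}
    (h : ∀ y ∈ l', y ∈ V.image f) : ∃ l : List α, (∀ x ∈ l, x ∈ V) ∧ l.map f = l' := by
  induction l' with
  | nil => exact ⟨[], by simp, rfl⟩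
  | cons y l' ih =>
    obtain ⟨l, hl, rfl⟩ := ih fun z hz => h z (List.mem_cons_of_mem _ hz)
    obtain ⟨x, hx, rfl⟩ := Finset.mem_image.1 (h y List.mem_cons_self)
    exact ⟨x :: l, fun z hz => by
      rcases List.mem_cons.1 hz with rfl | hz
      exacts [hx, hl z hz], rfl⟩

omit [DecidableEq α] in
/-- `toFinset` of a mapped list is the image of `toFinset`. [folklore] -/
theorem toFinset_map_eq_image [DecidableEq α] (l : List α) (f : α → β) :
    (l.map f).toFinset = l.toFinset.image f := by
  ext y; simp

/-- **Pushing a Hamiltonian path forward along an injective relabelling** that preserves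
adjacency on `V`. [folklore] -/
theorem isHamPathOn_map_of_adj {f : α → β} (hf : Function.Injective f)
    {G : _root_.SimpleGraph α} {G' : _root_.SimpleGraph β} {V : Finset α}
    (hG : ∀ a ∈ V, ∀ b ∈ V, G.Adj a b → G'.Adj (f a) (f b))
    {s t : α} {l : List α} (h : IsHamPathOn G V s t l) :
    IsHamPathOn G' (V.image f) (f s) (f t) (l.map f) := by
  have hmem : ∀ x ∈ l, x ∈ V := fun x hx => h.mem_iff.1 hx
  obtain ⟨hnd, hV, hh, ht, hch⟩ := h
  refine ⟨hnd.map hf, by rw [toFinset_map_eq_image, hV], by rw [List.head?_map, hh]; rfl,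
    by rw [List.getLast?_map, ht]; rfl, ?_⟩
  rw [List.isChain_map]
  rw [List.IsChain.iff_mem] at hch ⊢
  exact hch.imp fun a b ⟨ha, hb, hab⟩ => ⟨ha, hb, hG a (hmem a ha) b (hmem b hb) hab⟩

/-- **Pulling a Hamiltonian path back along an injective relabelling**: a Hamiltonian path of
`G'` through `V.image f` between images of vertices is the image of a Hamiltonian path of `G`,
provided `f` reflects adjacency on `V`. [folklore] -/
theorem exists_isHamPathOn_of_map {f : α → β} (hf : Function.Injective f)
    {G : _root_.SimpleGraph α} {G' : _root_.SimpleGraph β} {V : Finset α}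
    (hG : ∀ a ∈ V, ∀ b ∈ V, G'.Adj (f a) (f b) → G.Adj a b)
    {s t : α} {l' : List β} (h : IsHamPathOn G' (V.image f) (f s) (f t) l') :
    ∃ l, IsHamPathOn G V s t l ∧ l.map f = l' := by
  obtain ⟨l, hlV, rfl⟩ := exists_map_eq_of_forall_mem_image (f := f) (V := V)
    (fun y hy => h.mem_iff.1 hy)
  obtain ⟨hnd, hV, hh, ht, hch⟩ := h
  refine ⟨l, ⟨(List.nodup_map_iff hf).1 hnd, ?_, ?_, ?_, ?_⟩, rfl⟩
  · rw [toFinset_map_eq_image] at hV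
    exact Finset.image_injective hf hV
  · rw [List.head?_map] at hh
    cases hl : l.head? with
    | none => simp [hl] at hh
    | some x =>
      rw [hl] at hh
      simp only [Option.map_some, Option.some.injEq] at hh
      rw [hf hh]
  · rw [List.getLast?_map] at ht
    cases hl : l.getLast? with
    | none => simp [hl] at ht
    | some x =>
      rw [hl] at ht
      simp only [Option.map_some, Option.some.injEq] at ht
      rw [hf ht]
  · rw [List.isChain_map] at hch
    rw [List.IsChain.iff_mem] at hch ⊢
    exact hch.imp fun a b ⟨ha, hb, hab⟩ => ⟨ha, hb, hG a (hlV a ha) b (hlV b hb) hab⟩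

/-- **Relabelling invariance of the constrained counts**: along an injective `f` that preserves
and reflects adjacency on `V`, the number of Hamiltonian `s`–`t` paths of `G` through `V` with
required edges `R` and forbidden edges `F` equals the number of Hamiltonian `f s`–`f t` paths of
`G'` through `V.image f` with the pushed-forward constraints. [folklore] -/
theorem hamCountRF_image {f : α → β} (hf : Function.Injective f)
    {G : _root_.SimpleGraph α} {G' : _root_.SimpleGraph β} {V : Finset α}
    (hG : ∀ a ∈ V, ∀ b ∈ V, G.Adj a b ↔ G'.Adj (f a) (f b))
    (s t : α) (R F : Finset (α × α)) :
    hamCountRF G' (V.image f) (f s) (f t) (R.image (Prod.map f f)) (F.image (Prod.map f f)) =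
      hamCountRF G V s t R F := by
  unfold hamCountRF
  have hset : hamSetRF G' (V.image f) (f s) (f t) (R.image (Prod.map f f)) (F.image (Prod.map f f)) =
      List.map f '' hamSetRF G V s t R F := by
    ext l'
    constructor
    · rintro ⟨hl', hR, hF⟩
      obtain ⟨l, hl, rfl⟩ :=
        exists_isHamPathOn_of_map hf (fun a ha b hb h => (hG a ha b hb).2 h) hl'
      refine ⟨l, ⟨hl, fun e he => ?_, fun e he hu => ?_⟩, rfl⟩
      · exact (uses_map_iff hf).1 (hR (Prod.map f f e) (Finset.mem_image_of_mem _ he))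
      · exact hF (Prod.map f f e) (Finset.mem_image_of_mem _ he) ((uses_map_iff hf).2 hu)
    · rintro ⟨l, ⟨hl, hR, hF⟩, rfl⟩
      refine ⟨isHamPathOn_map_of_adj hf (fun a ha b hb h => (hG a ha b hb).1 h) hl,
        fun e' he' => ?_, fun e' he' hu => ?_⟩
      · obtain ⟨e, he, rfl⟩ := Finset.mem_image.1 he'
        exact (uses_map_iff hf).2 (hR e he)
      · obtain ⟨e, he, rfl⟩ := Finset.mem_image.1 he'
        exact hF e he ((uses_map_iff hf).1 hu)
  rw [hset, Set.ncard_image_of_injective _ (List.map_injective_iff.2 hf)]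

/-- **Relabelling invariance of `hamCount`.** [folklore] -/
theorem hamCount_image {f : α → β} (hf : Function.Injective f)
    {G : _root_.SimpleGraph α} {G' : _root_.SimpleGraph β} {V : Finset α}
    (hG : ∀ a ∈ V, ∀ b ∈ V, G.Adj a b ↔ G'.Adj (f a) (f b)) (s t : α) :
    hamCount G' (V.image f) (f s) (f t) = hamCount G V s t := by
  have h := hamCountRF_image hf hG s t ∅ ∅
  rw [hamCount_eq, hamCount_eq]
  simpa only [Finset.image_empty] using h

end relabel

/-! ### Numbered instances -/

/-- **From a structured gadget graph to a numbered instance**: if the injective numbering `f`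
sends the vertex set `V` onto `{0, …, N - 1}` and, between numbers of vertices of `V`, the edge
list `D` joins exactly the adjacent pairs of `G`, then the `#HamPath` value of the instance
`(N, D, f s, f t)` is the Hamiltonian-path count of `G` through `V` from `s` to `t`.
[cite: LiskiewiczOgiharaToda2003, §2.3 (#HamPath) and §4 (the instances (E₀, s′, t′))] -/
theorem hamPathCount_eq_hamCount_of_numbering {α : Type*} [DecidableEq α] {f : α → ℕ}
    (hf : Function.Injective f) {G : _root_.SimpleGraph α} {V : Finset α} {N : ℕ}
    {D : List DrawnEdge} (hV : V.image f = Finset.range N)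
    (hD : ∀ a ∈ V, ∀ b ∈ V, G.Adj a b ↔ (f a ≠ f b ∧ DAdj D (f a) (f b))) (s t : α) :
    hamPathCount N D (f s) (f t) = hamCount G V s t := by
  rw [hamPathCount_eq_hamCount, ← hV]
  exact hamCount_image hf (fun a ha b hb => (hD a ha b hb).trans (drawnGraph_adj D _ _).symm) s t

/-! ### Sanity check -/

/-- On the one-edge instance of `GridSAWCountingViaGridHamPath.lean` both counts are `1`.
[folklore] -/
theorem hamCount_drawnGraph_oneEdge :
    hamCount (drawnGraph oneEdgeDrawing.2) (Finset.range 2) 0 1 = 1 := by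
  rw [← hamPathCount_eq_hamCount, hamPathCount_oneEdge]

end Literature.Barriers.CriticalPhenomena.GridSAW
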